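/- Copyright: the b2b-balaban cell (near-miss cell 7), T⁴-continuum fan-out, lineage t4-ne7b-formalise-leaf-02 (NE7b
CRUX team (2), leaf prover 02; gen 107 sketch a5ac9cfa227d98de §5, gen 108 re-base) — (α)-instance, (A3) module J1
(tower instance), companion: the junction with M2-B's `weight_le_evProd` BY NAME; INTERFACE REQUEST NE7b IR-99-1 of
the row OWNER `t4-ne7b-p1` («split §5 off if needed», ruling W-ne7bp1-g99-1).  Released under the licence of the
surrounding project. -/
import Summits.QuantumFields.BalabanUV.T4Continuum.Support.B16HistoryReprRead

/-!
# (α)-INSTANCE, (A3) module J1, companion: M2-B's weight bound AT THE TOWER INSTANCE (the junction by name)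

Summits-side support leaf of the T⁴-continuum cell (rung (B)+1 on a FINITE torus only; NOT infinite volume, NOT the
mass gap, NOT Clay; NOT a proof of NE7b — the cell's OWN estimate, NOT PRINTED, NOT PROVED).  [folklore] one
application of M2-B's `weight_le_evProd` (`B16HistoryInputFamily`) at `I := skelFam`, `R := reprFam` (IR-97-2 part 2),
`Φf := factorsOf`, `hR := histRead_tower` (`B16HistoryReprRead`); nothing printed is asserted, no `def … : Prop` fact
of Bałaban's, no cite-tagged hypothesis, zero `sorry`.  Split off `B16HistoryReprRead` for the 400-line lint only.

WHAT.  **`weight_le_evProd_tower`**: for a term `τ ∈ termSet (skelFam T p₀) K` of the tower's normalised history-term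
family, `K₀ ≤ K`, `|t| ≤ l₀`, under the per-step unit-weight envelopes `hw`, the bound `hBρ` of the dressed initial
density, the per-history factorisation displays `hfacZ`∕`hfac0` and the END's per-term binders `NewOK` ∕ `Rm ≤ R`
verbatim, M2-A's weight of `τ` is at most (per-level domain costs) · (live and dead event products along the
process's pedigree) · `rest` — M2-B's conclusion, letter for letter, so a consumer holding M2-B's right-hand side for
a general `R` holds it for the tower by this name.

NOT HERE (honest).  Everything `B16HistoryReprRead` lists as not there (which tower, the reading, the content of the
displays, M5, any estimate).  BY-NAME EFFECT ON THE WALL: NONE.  HONEST DEPENDENCY (cell): continuum YM on T⁴ ⇐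
BetaPertH ∧ nine spine estimates (0/9 proved); BetaPertH ⇐ (D1) ∧ (D4) ∧ CAP+tail; G-an2-4 gates asym, D1 and
NE2/3/4.  This file changes none of it.
-/

open Finset MeasureTheory
open Literature.MathematicalPhysics.QuantumFieldTheory.Balaban1983to89
open Summit.QuantumFields.BalabanUV.T4Continuum.HistoryAdmissible
open Summit.QuantumFields.BalabanUV.T4Continuum.HistoryGen
open Summit.QuantumFields.BalabanUV.T4Continuum.HistoryGenealogyExtraction
open Summit.QuantumFields.BalabanUV.T4Continuum.HistoryGenealogyRealise
open Summit.QuantumFields.BalabanUV.T4Continuum.HistoryGenealogyInstantiate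
open Summit.QuantumFields.BalabanUV.T4Continuum.HistoryGenealogyPedigree
open Summit.QuantumFields.BalabanUV.T4Continuum.HistoryRealiseWeakCells
open Summit.QuantumFields.BalabanUV.T4Continuum.HistoryTouchComponents

namespace Summit.QuantumFields.BalabanUV.T4Continuum.B16HistoryReprRead

open Summit.QuantumFields.BalabanUV.T4Continuum.B16HistoryIndexedRepr
open Summit.QuantumFields.BalabanUV.T4Continuum.B16HistoryReprChain
open Summit.QuantumFields.BalabanUV.T4Continuum.B16HistoryReprInstance

noncomputable section

section Junction

variable {P : Type} [DecidableEq P] {C : ℕ → ℕ → Type} {𝒢 : (K j : ℕ) → GoodClass (C K j)}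
  (T : (K : ℕ) → Tower P (C K) (𝒢 K)) (p₀ : ℕ → ℕ → P)
  (ρ₀ : (K : ℕ) → ℝ → C K 0 → ℝ) (hρ : ∀ K t, (𝒢 K 0).Gd (ρ₀ K t)) (h0 : ∀ K t x, 0 ≤ ρ₀ K t x)
  (B : ℕ → ℝ → ℝ) (hB : ∀ K t, 0 < B K t)
  {d : ℕ} (fB : ℕ → ℕ → ℕ → Lab d → ℝ) (fR : ℕ → ℕ → ℝ) (Λ : ℕ → ℕ → ℝ) (hΛ : ∀ K j, 1 ≤ Λ K j)
  (w : (K : ℕ) → (j : ℕ) → (Fin j → P) → P → ℝ) (ℛ : HistReading (skelFam T p₀) d)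

/-- **THE WEIGHT OF A TOWER TERM IS BOUNDED BY THE EVENT PRODUCTS ALONG ITS PROCESS's PEDIGREE** — M2-B's
`weight_le_evProd` AT the tower instance (`I := skelFam`, `R := reprFam`, `Φf := factorsOf`, `hR := histRead_tower`),
under the END's per-term binders `NewOK` ∕ `Rm ≤ R` verbatim: the junction closes by name. [folklore] -/
theorem weight_le_evProd_tower [∀ K, MeasurableSpace (C K K)] (μ : (K : ℕ) → Measure (C K K))
    [∀ K, IsFiniteMeasure (μ K)] {l₀ : ℝ} {K₀ : ℕ} (hw0 : ∀ K j g p, 0 ≤ w K j g p)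
    (hw : ∀ K, K₀ ≤ K → ∀ j g p x, ((T K).op j g p).T (fun _ => 1) x ≤ w K j g p)
    (hBρ : ∀ K t, |t| ≤ l₀ → K₀ ≤ K → ∀ y, |ρ₀ K t y| ≤ B K t)
    (hfacZ : ∀ K t, |t| ≤ l₀ → K₀ ≤ K → ∀ h ∈ ((T K).adm K).erase (hsmall (p₀ K) K),
      Tower.wAlong (w K) K h ≤ ∏ j ∈ Finset.range (K + 1), ∏ c ∈ (ℛ.runOf K true (h, (), ())).histM.comp j,
        (factorsOf T p₀ B fB fR Λ hΛ w).levelFactor (ℛ.runOf K true (h, (), ())).histM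
          (ℛ.runOf K true (h, (), ())).rnwM K j c)
    (hfac0 : ∀ K t, |t| ≤ l₀ → K₀ ≤ K →
      1 ≤ ∏ j ∈ Finset.range (K + 1), ∏ c ∈ (ℛ.runOf K false (hsmall (p₀ K) K, (), ())).histM.comp j,
        (factorsOf T p₀ B fB fR Λ hΛ w).levelFactor (ℛ.runOf K false (hsmall (p₀ K) K, (), ())).histM
          (ℛ.runOf K false (hsmall (p₀ K) K, (), ())).rnwM K j c)
    (hN : ∀ K, K₀ ≤ K → ∀ τ ∈ HIndex.termSet (skelFam T p₀) K, (ℛ.inputOf.run K τ).NewOK)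
    (hRm : ∀ K, K₀ ≤ K → ∀ τ ∈ HIndex.termSet (skelFam T p₀) K, ∀ s k,
      (ℛ.inputOf.run K τ).Rm s k ≤ (ℛ.inputOf.run K τ).R s)
    {K : ℕ} (hK : K₀ ≤ K) {t : ℝ} (ht : |t| ≤ l₀) {τ : HIndex.Idx (skelFam T p₀)}
    (hτ : τ ∈ HIndex.termSet (skelFam T p₀) K) :
    Repr172R.weight μ (reprFam T p₀ ρ₀ hρ h0 B hB) t τ ≤
      (∏ j ∈ Finset.range (K + 1), ∏ c ∈ (ℛ.inputOf.run K τ).histM.comp j,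
          (factorsOf T p₀ B fB fR Λ hΛ w).Λ K j ^ (c.2).card) *
        ((∏ c ∈ ℛ.inputOf.liveC K τ, evProd ((factorsOf T p₀ B fB fR Λ hΛ w).fB K)
            ((factorsOf T p₀ B fB fR Λ hΛ w).fR K) ((ℛ.inputOf.ped K τ).toPGen id c)) *
          ∏ j ∈ Finset.range K, ∏ c ∈ (ℛ.inputOf.run K τ).histM.died j,
            evProd ((factorsOf T p₀ B fB fR Λ hΛ w).fB K) ((factorsOf T p₀ B fB fR Λ hΛ w).fR K)
              ((ℛ.inputOf.ped K τ).toPGen id (j, c))) *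
        (factorsOf T p₀ B fB fR Λ hΛ w).rest (fun K => (μ K).real Set.univ) t τ :=
  weight_le_evProd ℛ _ μ _ (histRead_tower T p₀ ρ₀ hρ h0 B hB fB fR Λ hΛ w ℛ hw0 hw hBρ hfacZ hfac0) hN hRm hK ht hτ

end Junction

end

end Summit.QuantumFields.BalabanUV.T4Continuum.B16HistoryReprRead
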